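import Literature.Analysis.FluidPDE.AncientMildWeak
import Literature.Analysis.FluidPDE.BoundedAnnihilator
import Literature.Analysis.FluidPDE.AxisymmetricVorticityTransport
import Literature.Analysis.FluidPDE.WholeSpaceIBP
import HarnessLib

/-!
# KNSS 2009, Theorem 5.2 in the tree's mild class, from the theorem in print

Analysis/FluidPDE proofs file for the named fact
`Literature.Analysis.FluidPDE.knss2009_axisymmetric_no_swirl` (`SelfSimilarLiouville`; the
print-faithful correction of `Literature.Analysis.FluidPDE.knss_axisymmetric_no_swirl`):
Koch–Nadirashvili–Seregin–Šverák, Acta Math. 203 (2009) = arXiv:0709.3599, **Theorem 5.2** —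
a bounded weak solution of Navier–Stokes in `ℝ³ × (−∞, 0)` which is axisymmetric with no swirl is
`u(x, t) = (0, 0, b₃(t))`.

The fact is stated in the tree's duality-form class of bounded ancient mild solutions
(`Fluid.IsBoundedAncientMildSolution 1 u`, jointly measurable on the slab, measurable slices,
pointwise axisymmetric swirl-free slices, conclusion `u t =ᵐ β • e_z` at *every* `t < 0`), the
theorem in print for KNSS's bounded weak solutions (`Fluid.IsBoundedWeakNSSolutionOn`, a.e.
hypotheses, conclusion for a.e. `t < 0`; vendored as the named fact
`Literature.Analysis.FluidPDE.KNSS2009_liouville_axisymmetric_no_swirl`, `KNSSLiouville`). This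
file proves the **reduction of the former to the latter**,

* `Literature.Analysis.FluidPDE.knss2009_axisymmetric_no_swirl_of_KNSS2009`:
  `KNSS2009_liouville_axisymmetric_no_swirl → knss2009_axisymmetric_no_swirl`,

so that discharging Theorem 5.2 as printed discharges the mild-class fact. The bridge consists of

1. **mild ⇒ weak** (`IsBoundedAncientMildSolution.isBoundedWeakNSSolutionOn`, `AncientMildWeak`):
   the duality-form solution is a bounded weak solution in KNSS's sense;
2. Theorem 5.2 in print: `u t = b(t) e_z` a.e. in `x`, for a.e. `t < 0`;
3. **every slice** (`IsBoundedAncientMildSolution.integral_inner_eq_zero_of_ae_const`): the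
   pairings `t ↦ ⟨u(t), φ⟩` with divergence-free tests are continuous on `(−∞, 0)`
   (`AncientMildPairing`) and vanish for a.e. `t` (a constant pairs to zero with a divergence-free
   compactly supported field, `integral_inner_const_eq_zero_of_isDivFree`), hence vanish at every
   `t < 0`; so every slice is a bounded weakly divergence-free field annihilating the solenoidal
   tests, and is a.e. constant by KNSS's Liouville step ("bounded solutions of `curl z = 0`,
   `div z = 0` are constant", Lemma 3.1; `BoundedAnnihilator`);
4. **symmetry of the constant** (`eq_smul_eZ_of_ae_eq_const_of_isAxisymmetric`): a pointwise
   axisymmetric field a.e. equal to a constant `c` has `c = R_π c`, i.e. `c ∥ e_z`.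

Also recorded: the corrected fact threads to the three consumers of the interim one (the last
line of the proof of Theorem 5.3, `…ae_eq_zero_of_bound`; the swirl-free case of Theorem 5.3,
`knss2009_bound_C_over_r_of_hasNoSwirl`; the `ℝ³`-valued constancy, `SelfSimilarLiouville`).

## References

* G. Koch, N. Nadirashvili, G. Seregin, V. Šverák, *Liouville theorems for the Navier–Stokes
  equations and applications*, Acta Math. 203 (2009) 83–105 = arXiv:0709.3599: Theorem 5.2 and
  its proof (pp. 9–10), Lemma 3.1 (p. 7), §4 (i)–(ii) (p. 8), proof of Theorem 5.3, last line
  (p. 10). [KochNadirashviliSereginSverak2009]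
-/

noncomputable section

open MeasureTheory Set Function Filter TopologicalSpace InnerProductSpace
open scoped RealInnerProductSpace

namespace Literature.Analysis.FluidPDE

/-! ### A constant pairs to zero with a compactly supported divergence-free field -/

section ZeroMean

variable {E : Type*} [NormedAddCommGroup E] [InnerProductSpace ℝ E] [FiniteDimensional ℝ E]
  [MeasurableSpace E] [BorelSpace E]

omit [MeasurableSpace E] [BorelSpace E] in
/-- The gradient of the linear functional `x ↦ ⟪c, x⟫` is the constant vector `c`. [folklore] -/
theorem gradient_inner_const_left (c x : E) : gradient (fun y => ⟪c, y⟫) x = c := by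
  have h : HasFDerivAt (fun y => ⟪c, y⟫) (innerSL ℝ c) x := (innerSL ℝ c).hasFDerivAt
  rw [gradient, h.fderiv]
  apply (InnerProductSpace.toDual ℝ E).injective
  rw [LinearIsometryEquiv.apply_symm_apply]
  ext y
  simp [InnerProductSpace.toDual_apply_apply]

/-- **Compactly supported divergence-free fields have zero mean**: `∫ ⟪c, φ⟫ = 0` for every
constant `c` and every `φ ∈ C¹_c(E; E)` with `div φ = 0` (`⟪c, φ⟫ = div(⟪c, x⟫ φ)` and the
divergence theorem without boundary; this is why the duality-form and the weak classes of KNSS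
do not see the parasitic solutions `u(x, t) = b(t)`, arXiv:0709.3599 §1 p. 3). [cite: KochNadirashviliSereginSverak2009, §1 p. 3 (parasitic solutions b(t))] -/
theorem integral_inner_const_eq_zero_of_isDivFree (c : E) {φ : E → E} (hφ : ContDiff ℝ 1 φ)
    (hc : HasCompactSupport φ) (hdiv : VectorCalculus.IsDivFree φ) : ∫ x, ⟪c, φ x⟫ = 0 := by
  have hθ : ContDiff ℝ 1 fun y : E => ⟪c, y⟫ := (innerSL ℝ c).contDiff
  have h := integral_mul_divergence_add_eq_zero_right hθ hφ hc
  have h0 : (fun x => ⟪c, x⟫ * VectorCalculus.divergence φ x) = fun _ => 0 :=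
    funext fun x => by rw [hdiv x, mul_zero]
  rw [h0, integral_zero, zero_add] at h
  simp_rw [gradient_inner_const_left, real_inner_comm c] at h
  rw [← h]

end ZeroMean

/-! ### From a.e. `t` to every `t`: slices of bounded ancient mild solutions -/

section EverySlice

variable {E : Type*} [NormedAddCommGroup E] [InnerProductSpace ℝ E] [FiniteDimensional ℝ E]
  [MeasurableSpace E] [BorelSpace E]

/-- **Every slice pairs to zero if almost every slice is a.e. constant.** Let `u` be a bounded
ancient mild solution (`0 < ν`) with measurable slices, and suppose that for a.e. `t < 0` the
slice `u t` is a.e. equal to a constant. Then for *every* `t < 0` and every smooth compactly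
supported divergence-free `φ`, `∫ ⟪u t, φ⟫ = 0`: the pairing is continuous in `t` on `(−∞, 0)`
(`IsBoundedAncientMildSolution.continuousOn_integral_inner`, the two-time identity), and it
vanishes for a.e. `t` since constants pair to zero with `φ`; a continuous function vanishing a.e.
on an open set vanishes there. [folklore] -/
theorem IsBoundedAncientMildSolution.integral_inner_eq_zero_of_ae_const {ν : ℝ} {u : ℝ → E → E}
    (hu : IsBoundedAncientMildSolution ν u) (hν : 0 < ν)
    (hmeas : ∀ t < 0, AEStronglyMeasurable (u t) volume) {c : ℝ → E}
    (hconst : ∀ᵐ t ∂((volume : Measure ℝ).restrict (Iio 0)), u t =ᵐ[volume] fun _ => c t)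
    {φ : E → E} (hφ : FunctionSpaces.IsTestFunctionOn (⊤ : Opens E) φ)
    (hdiv : VectorCalculus.IsDivFree φ) : ∀ t < 0, ∫ x, ⟪u t x, φ x⟫ = 0 := by
  have hcont : ContinuousOn (fun t => ∫ x, ⟪u t x, φ x⟫) (Iio 0) :=
    hu.continuousOn_integral_inner hν hmeas hφ hdiv
  have hφ1 : ContDiff ℝ 1 φ := hφ.contDiff.of_le (by exact_mod_cast le_top)
  -- the pairing vanishes for a.e. `t < 0`
  have hae : (fun t => ∫ x, ⟪u t x, φ x⟫) =ᵐ[(volume : Measure ℝ).restrict (Iio 0)] fun _ => 0 := by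
    filter_upwards [hconst] with t ht
    have h1 : ∫ x, ⟪u t x, φ x⟫ = ∫ x, ⟪c t, φ x⟫ :=
      integral_congr_ae (by filter_upwards [ht] with x hx; rw [hx])
    rw [h1, integral_inner_const_eq_zero_of_isDivFree (c t) hφ1 hφ.hasCompactSupport hdiv]
  -- a continuous function vanishing a.e. on an open set vanishes there
  have heq : EqOn (fun t => ∫ x, ⟪u t x, φ x⟫) (fun _ => (0 : ℝ)) (Iio 0) :=
    Measure.eqOn_open_of_ae_eq hae isOpen_Iio hcont continuousOn_const
  exact fun t ht => heq ht

/-- **Every slice of such a solution is a.e. constant** (bounded, weakly divergence free, and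
annihilating the solenoidal tests by `integral_inner_eq_zero_of_ae_const`; then KNSS's Liouville
step "bounded solutions of `curl z = 0`, `div z = 0` in `ℝⁿ` are constant", Lemma 3.1, in the weak
form `IsWeaklyDivFree.exists_ae_eq_const_of_norm_le_of_forall_integral_inner_eq_zero`). [cite: KochNadirashviliSereginSverak2009, Lemma 3.1 (arXiv p. 7)] -/
theorem IsBoundedAncientMildSolution.exists_ae_eq_const_slice [Nontrivial E] {ν : ℝ}
    {u : ℝ → E → E} (hu : IsBoundedAncientMildSolution ν u) (hν : 0 < ν)
    (hmeas : ∀ t < 0, AEStronglyMeasurable (u t) volume) {c : ℝ → E}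
    (hconst : ∀ᵐ t ∂((volume : Measure ℝ).restrict (Iio 0)), u t =ᵐ[volume] fun _ => c t) :
    ∀ t < 0, ∃ c' : E, u t =ᵐ[volume] fun _ => c' := by
  intro t ht
  obtain ⟨M, hM⟩ := hu.2
  exact IsWeaklyDivFree.exists_ae_eq_const_of_norm_le_of_forall_integral_inner_eq_zero
    (hmeas t ht) (fun x => hM t ht x) (hu.1.1 t ht)
    (fun φ hφ hdivφ => hu.integral_inner_eq_zero_of_ae_const hν hmeas hconst hφ hdivφ t ht)

end EverySlice

/-! ### The constant of an axisymmetric slice is axial -/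

section Axial

/-- The rotations about the axis preserve Lebesgue measure (linear isometries). [folklore] -/
theorem measurePreserving_rotZ (θ : ℝ) :
    MeasurePreserving (rotZ θ) (volume : Measure (EuclideanSpace ℝ (Fin 3))) volume :=
  (rotZLIE θ).measurePreserving

/-- The half-turn about the axis: `R_π x = (−x₀, −x₁, x₂)`. [folklore] -/
theorem rotZ_pi (x : EuclideanSpace ℝ (Fin 3)) :
    rotZ Real.pi x = WithLp.toLp 2 ![-x 0, -x 1, x 2] := by
  ext i
  fin_cases i <;> simp [Real.cos_pi, Real.sin_pi]

/-- A vector fixed by the half-turn about the axis is axial: `R_π c = c → c = c₂ e_z`. [folklore] -/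
theorem eq_smul_eZ_of_rotZ_pi_eq {c : EuclideanSpace ℝ (Fin 3)} (h : rotZ Real.pi c = c) :
    c = c 2 • eZ := by
  rw [rotZ_pi] at h
  have h0 : -c 0 = c 0 := by simpa using congrFun (congrArg (⇑) h) 0
  have h1 : -c 1 = c 1 := by simpa using congrFun (congrArg (⇑) h) 1
  have hc0 : c 0 = 0 := by linarith
  have hc1 : c 1 = 0 := by linarith
  ext i
  fin_cases i <;> simp [eZ, hc0, hc1]

/-- **The constant of an axisymmetric slice is axial.** If `v : ℝ³ → ℝ³` is pointwise
axisymmetric (`v (R_θ x) = R_θ (v x)`) and a.e. equal to a constant `c`, then `c = c₂ e_z`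
(compose the a.e. identity with the measure-preserving half-turn `R_π` and compare at a common
point: `c = v(R_π x) = R_π v(x) = R_π c`). This is the passage from "constant in `x`" to KNSS's
"`u(x,t) = (0, 0, b₃(t))`" for axisymmetric fields (Thm 5.2). [cite: KochNadirashviliSereginSverak2009, Thm 5.2 (arXiv p. 9)] -/
theorem eq_smul_eZ_of_ae_eq_const_of_isAxisymmetric
    {v : EuclideanSpace ℝ (Fin 3) → EuclideanSpace ℝ (Fin 3)} (hv : IsAxisymmetric v)
    {c : EuclideanSpace ℝ (Fin 3)} (hc : v =ᵐ[volume] fun _ => c) : c = c 2 • eZ := by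
  have h1 : ∀ᵐ x ∂(volume : Measure (EuclideanSpace ℝ (Fin 3))), v (rotZ Real.pi x) = c :=
    (measurePreserving_rotZ Real.pi).quasiMeasurePreserving.ae hc
  have h2 : ∀ᵐ x ∂(volume : Measure (EuclideanSpace ℝ (Fin 3))), rotZ Real.pi c = c := by
    filter_upwards [hc, h1] with x hx hx'
    calc rotZ Real.pi c = rotZ Real.pi (v x) := by rw [hx]
      _ = v (rotZ Real.pi x) := (hv Real.pi x).symm
      _ = c := hx'
  obtain ⟨x, hx⟩ := h2.exists
  exact eq_smul_eZ_of_rotZ_pi_eq hx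

end Axial

/-! ### Theorem 5.2 in the mild class from the theorem in print -/

section Main

/-- **KNSS 2009, Theorem 5.2: the print-faithful mild-class fact follows from the theorem in
print.** Assume Theorem 5.2 for KNSS's bounded weak solutions
(`KNSS2009_liouville_axisymmetric_no_swirl`: an `L^∞(ℝ³ × (−∞, 0))` weak solution, axisymmetric
and swirl-free a.e., is `b(t) e_z` a.e. in `x` for a.e. `t < 0`). Then every bounded ancient mild
solution in the tree's duality form (`ν = 1`) which is jointly measurable on the slab, with
measurable, pointwise axisymmetric and swirl-free slices, satisfies `u t =ᵐ β • e_z` at *every*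
`t < 0` (`knss2009_axisymmetric_no_swirl`). Proof: mild ⇒ weak
(`IsBoundedAncientMildSolution.isBoundedWeakNSSolutionOn`); Theorem 5.2 with pointwise
hypotheses (`…of_pointwise`); every slice is a.e. constant (`exists_ae_eq_const_slice`, via the
time continuity of the solenoidal pairings and KNSS's Liouville step, Lemma 3.1); the constant is
axial by axisymmetry (`eq_smul_eZ_of_ae_eq_const_of_isAxisymmetric`). [cite: KochNadirashviliSereginSverak2009, Thm 5.2 (arXiv pp. 9–10)] -/
theorem knss2009_axisymmetric_no_swirl_of_KNSS2009 (h52 : KNSS2009_liouville_axisymmetric_no_swirl) :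
    knss2009_axisymmetric_no_swirl := by
  intro u hu hjoint hmeas haxi hswirl t ht
  have hν : (0 : ℝ) < 1 := one_pos
  -- (1) mild ⇒ weak
  have hweak : IsBoundedWeakNSSolutionOn (Iio 0) isOpen_Iio 1 u :=
    hu.isBoundedWeakNSSolutionOn hν hjoint hmeas
  -- (2) Theorem 5.2 in print, pointwise hypotheses
  obtain ⟨b, -, -, hb⟩ := KNSS2009_liouville_axisymmetric_no_swirl.of_pointwise h52 hweak haxi hswirl
  -- (3) every slice is a.e. constant
  obtain ⟨c, hc⟩ := hu.exists_ae_eq_const_slice hν hmeas (c := fun t => b t • eZ) hb t ht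
  -- (4) the constant is axial
  exact ⟨c 2, (eq_smul_eZ_of_ae_eq_const_of_isAxisymmetric (haxi t ht) hc) ▸ hc⟩

/-- **The last line of the proof of Theorem 5.3 for the corrected fact** (arXiv:0709.3599
p. 10: "the solution `u` is swirl-free and we can apply Theorem 5.2 to conclude that `u = 0`"):
under `knss2009_axisymmetric_no_swirl`, a jointly measurable bounded ancient mild solution with
measurable, axisymmetric, swirl-free slices and the decay `r ‖u(t, x)‖ ≤ C` vanishes a.e. on
every slice `t < 0` (Theorem 5.2 gives `u t =ᵐ β e_z`, and the bound forces `β = 0`,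
`smul_eZ_eq_zero_of_ae_eq_of_cylRadius_mul_norm_le`). [cite: KochNadirashviliSereginSverak2009, proof of Thm 5.3, last paragraph (arXiv p. 10)] -/
theorem knss2009_axisymmetric_no_swirl.ae_eq_zero_of_bound (h52 : knss2009_axisymmetric_no_swirl)
    {u : ℝ → EuclideanSpace ℝ (Fin 3) → EuclideanSpace ℝ (Fin 3)} (hu : IsBoundedAncientMildSolution 1 u)
    (hjoint : AEStronglyMeasurable (uncurry u)
      (volume.restrict (Iio (0 : ℝ) ×ˢ (univ : Set (EuclideanSpace ℝ (Fin 3))))))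
    (hmeas : ∀ t < 0, AEStronglyMeasurable (u t) volume)
    (haxi : ∀ t < 0, IsAxisymmetric (u t)) (hswirl : ∀ t < 0, HasNoSwirl (u t))
    (hbound : ∃ C : ℝ, ∀ t < 0, ∀ x, cylRadius x * ‖u t x‖ ≤ C) :
    ∀ t < 0, u t =ᵐ[volume] 0 := by
  intro t ht
  obtain ⟨β, hβ⟩ := h52 hu hjoint hmeas haxi hswirl t ht
  obtain ⟨C, hC⟩ := hbound
  have h0 : β = 0 :=
    smul_eZ_eq_zero_of_ae_eq_of_cylRadius_mul_norm_le hβ (Eventually.of_forall (hC t ht))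
  filter_upwards [hβ] with x hx
  simp [hx, h0]

/-- **The swirl-free case of the corrected Theorem 5.3 follows from the corrected Theorem 5.2**
(packaged form of `knss2009_axisymmetric_no_swirl.ae_eq_zero_of_bound`; KNSS 2009, proof of
Thm 5.3, last paragraph). [cite: KochNadirashviliSereginSverak2009, proof of Thm 5.3, last paragraph (arXiv p. 10)] -/
theorem knss2009_bound_C_over_r_of_hasNoSwirl (h52 : knss2009_axisymmetric_no_swirl)
    {u : ℝ → EuclideanSpace ℝ (Fin 3) → EuclideanSpace ℝ (Fin 3)} (hu : IsBoundedAncientMildSolution 1 u)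
    (hjoint : AEStronglyMeasurable (uncurry u)
      (volume.restrict (Iio (0 : ℝ) ×ˢ (univ : Set (EuclideanSpace ℝ (Fin 3))))))
    (hmeas : ∀ t < 0, AEStronglyMeasurable (u t) volume)
    (haxi : ∀ t < 0, IsAxisymmetric (u t))
    (hbound : ∃ C : ℝ, ∀ t < 0, ∀ x, cylRadius x * ‖u t x‖ ≤ C)
    (hswirl : ∀ t < 0, HasNoSwirl (u t)) : ∀ t < 0, u t =ᵐ[volume] 0 :=
  knss2009_axisymmetric_no_swirl.ae_eq_zero_of_bound h52 hu hjoint hmeas haxi hswirl hbound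

/-- **The swirl-free case of Theorem 5.3 in the mild class, from Theorem 5.2 in print**
(composition of `knss2009_axisymmetric_no_swirl_of_KNSS2009` with the last line of the proof of
Theorem 5.3). [cite: KochNadirashviliSereginSverak2009, proof of Thm 5.3, last paragraph (arXiv p. 10)] -/
theorem knss2009_bound_C_over_r_of_hasNoSwirl_of_KNSS2009
    (h52 : KNSS2009_liouville_axisymmetric_no_swirl)
    {u : ℝ → EuclideanSpace ℝ (Fin 3) → EuclideanSpace ℝ (Fin 3)} (hu : IsBoundedAncientMildSolution 1 u)
    (hjoint : AEStronglyMeasurable (uncurry u)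
      (volume.restrict (Iio (0 : ℝ) ×ˢ (univ : Set (EuclideanSpace ℝ (Fin 3))))))
    (hmeas : ∀ t < 0, AEStronglyMeasurable (u t) volume)
    (haxi : ∀ t < 0, IsAxisymmetric (u t))
    (hbound : ∃ C : ℝ, ∀ t < 0, ∀ x, cylRadius x * ‖u t x‖ ≤ C)
    (hswirl : ∀ t < 0, HasNoSwirl (u t)) : ∀ t < 0, u t =ᵐ[volume] 0 :=
  knss2009_bound_C_over_r_of_hasNoSwirl (knss2009_axisymmetric_no_swirl_of_KNSS2009 h52) hu hjoint
    hmeas haxi hbound hswirl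

end Main

end Literature.Analysis.FluidPDE

end
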